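import Summits.ResolutionOfSingularities.ResolutionOfSingularities.Theorems.RadicialJungCleanModelsCleanPermissibleSeq
import Literature.AlgebraicGeometry.Resolution.KollarMonomialLocalExponents
import Literature.AlgebraicGeometry.Hironaka2017.Lib.QuotientRegularOfCotangent
import Mathlib.RingTheory.Derivation.Basic
import Mathlib.Data.ZMod.Basic
import Literature.RingTheory.Localization.DerivationFractionField
import HarnessLib

/-!
# Route `RadicialJung`, crux `CleanModels` (stmt-ResolutionOfSingularities-15917), line `Sketch` rev 35, stub 6 `stub_cleanProp44` (X44c):
# THE DERIVATION OBSTRUCTION TO CLEAN-PERMISSIBILITY (def-free kernel tool)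

Seat `leafhand-res-radicialjung-1` g0 (land-only hand).  X44c (`stub_cleanProp44`) is Cossart–Piltant 2008 Prop. 4.4 with every
centre required to be CLEAN-PERMISSIBLE (`CleanPermissibleAt`, `RadicialJungCleanModelsCleanPermissibleSeq.lean`) for the current
transform of the line of `G`.  The hands working X44c decide by hand, again and again, that a given regular curve `V(I)` is NOT
clean-permissible at a closed point (the lead's witness `G = t₁`, `Y = V(t₂, t₁ - t₃²)` quoted in the docstring of
`RadicialJungCleanModelsCleanPermissibleSeq.lean`; the crossing configuration of memo `Sketch-memo-hand2-g12-stubs-5-7.md` §3), always by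
the same mechanism: a derivation `D` of the function field killing `G` kills every representative `Σ c_j^p G^j` of the line, and
`D (u ∏ z_i^{e_i}) = 0` forces `z_i ∣ D z_i` for every member `z_i` of the adapted regular system of parameters whose exponent is prime
to `p`.  This file puts that mechanism in the kernel, once and for all, with no definitions:

* `IsRsopPart.dvd_derivation_apply_of_apply_eq_zero` — **the Leibniz divisibility**: `z` part of a regular system of parameters,
  `u` a unit, `d` a derivation of `R` with `d (u ∏ z_i^{e_i}) = 0`, `p ∤ e_i` ⟹ `z_i ∣ d z_i`.
* `derivation_rep_eq_zero` — a derivation of `F` killing `G` kills every representative `Σ c_j^p G^j` of the `F^p`-line of `G`.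
* `CleanPermissibleAt.exists_adapted_dvd_derivation` — **THE OBSTRUCTION**: if the residue field of `R` is `p`-perfect (every unit is a
  `p`-th power modulo `𝔪`, so form (2) is void) and the line of `G` is clean-permissible at `R` for `I`, then some `x` with
  «`x ∈ I ∖ 𝔪²`» or «`x ∈ 𝔪 ∖ (I + 𝔪²)`» satisfies `x ∣ d x` for EVERY derivation `d` of `R` that extends along `f : R → F` to a
  derivation of `F` killing `G`.
* `not_cleanPermissibleAt_of_derivations` — the contrapositive in the form used by hand: exhibit, for every such `x`, one compatible
  derivation with `x ∤ d x`.
* (appended) `derivation_prod_pow_eq_mul_sum`, `IsRsopPart.exists_logDerivative_of_apply_eq_zero`,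
  `IsRsopPart.sum_logDerivative_mem_maximalIdeal` — **second order**: `d zᵢ = zᵢ rᵢ` (`p ∤ eᵢ`) and `Σ eᵢ rᵢ = -d log u`, so `Σ eᵢ rᵢ ∈ 𝔪`
  when `d (R) ⊆ 𝔪` (excludes exceptional coordinates `z` with `d z = -z` as the prime-to-`p` member);
  `CleanPermissibleAt.exists_adapted_apply_eq_zero` — the raw adapted presentation killed by every compatible derivation.
* (appended) `exists_derivation_extend_fractionRing`, `not_cleanPermissibleAt_of_derivations_fractionRing` (derivations of `R` suffice when
  `F = Frac R`), `CleanPermissibleAt.of_mul_pow` (the line is invariant under `p`-th power factors).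
* Companion file `RadicialJungCleanModelsCleanPermissibleLeadWitness.lean`: the lead's witness `G = t₁`, `Y = V(t₂, t₁ - t₃²)` kernel-checked
  with this tool (clean-regular line, NOT clean-permissible curve; `p` odd, residue field `p`-perfect).

Honest framing: OURS, elementary commutative algebra (`Derivation`, `IsRsopPart`); a TOOL for the design of X44c
(deciding clean-permissibility of curve centres; the companion witness shows the restriction is genuine).  Nothing here proves X44c,
any case of `CleanModels`, or resolution of singularities in characteristic `p`.
Setting only: [cite: CossartPiltant2008, Prop. 4.4] [cite: Piltant2013, §2 Axiom 4] [cite: Matsumura1987, Thm. 14.2, Thm. 14.3].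
-/

noncomputable section

set_option linter.dupNamespace false -- mandated namespace of this single-conjunct summit

open IsLocalRing
open Literature.AlgebraicGeometry.Resolution

namespace Summit.ResolutionOfSingularities.ResolutionOfSingularities.Theorems.RadicialJung.CleanModels

universe u v

/-! ## Leibniz divisibility -/

/-- **Leibniz divisibility.**  Let `z` be part of a regular system of parameters of the local ring `R` (`char R = p` prime), `u` a
unit, `e` exponents and `d` a derivation of `R` with `d (u · ∏ᵢ zᵢ^{eᵢ}) = 0`.  Then `zᵢ ∣ d zᵢ` for every `i` with `p ∤ eᵢ`: expanding by
Leibniz and cancelling `zᵢ^{eᵢ-1}` (a regular local ring is a domain) gives `zᵢ ∣ u · eᵢ · (∏_{j≠i} z_j^{e_j}) · d zᵢ`, and `zᵢ` is a prime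
element dividing neither the unit `u`, nor the unit `eᵢ`, nor the complementary monomial. [cite: Matsumura1987, Thm. 14.3] -/
theorem _root_.Literature.AlgebraicGeometry.Resolution.IsRsopPart.dvd_derivation_apply_of_apply_eq_zero {R : Type u} [CommRing R]
    [IsLocalRing R] {N : ℕ} {z : Fin N → R} (hz : IsRsopPart z) (p : ℕ) [Fact p.Prime] [CharP R p] (d : Derivation ℤ R R)
    {u : R} (hu : IsUnit u) (e : Fin N → ℕ) (h0 : d (u * ∏ i, z i ^ e i) = 0) {i : Fin N} (hi : ¬ p ∣ e i) :
    z i ∣ d (z i) := by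
  classical
  haveI := hz.isRegularLocalRing
  haveI := isDomain_of_isRegularLocalRing R
  set Q : R := ∏ j ∈ Finset.univ.erase i, z j ^ e j with hQ
  have hP : ∏ j, z j ^ e j = z i ^ e i * Q := (Finset.mul_prod_erase _ _ (Finset.mem_univ i)).symm
  have hei : e i ≠ 0 := fun h => hi (h ▸ dvd_zero p)
  obtain ⟨k, hk⟩ : ∃ k, e i = k + 1 := Nat.exists_eq_succ_of_ne_zero hei
  -- Leibniz expansion of `d (u * (z i ^ (k+1) * Q))`
  have h1 : d (u * (z i ^ (k + 1) * Q)) =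
      u * (z i ^ (k + 1) * d Q + Q * (((k + 1 : ℕ) : R) * z i ^ k * d (z i))) + z i ^ (k + 1) * Q * d u := by
    rw [Derivation.leibniz, Derivation.leibniz, Derivation.leibniz_pow]
    simp only [smul_eq_mul, nsmul_eq_mul, Nat.add_sub_cancel]
    ring
  rw [hP, hk] at h0
  rw [h0] at h1
  -- cancel `z i ^ k`
  have h2 : z i ^ k * (u * Q * ((k + 1 : ℕ) : R) * d (z i) + z i * (u * d Q + Q * d u)) = 0 := by
    linear_combination (-1 : R) * h1
  have hzk : z i ^ k ≠ 0 := pow_ne_zero _ (hz.ne_zero i)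
  have h3 : u * Q * ((k + 1 : ℕ) : R) * d (z i) + z i * (u * d Q + Q * d u) = 0 :=
    (mul_eq_zero.mp h2).resolve_left hzk
  have hdvd : z i ∣ u * Q * ((k + 1 : ℕ) : R) * d (z i) :=
    ⟨-(u * d Q + Q * d u), by linear_combination h3⟩
  -- `z i` is prime and divides none of `u`, `Q`, `k + 1`
  have hprime := hz.prime i
  have hzu : ¬ z i ∣ u := fun h =>
    (hprime.not_unit) (isUnit_of_dvd_unit h hu)
  have hzQ : ¬ z i ∣ Q := by
    rw [hQ]; exact hz.not_dvd_prod_pow_erase e i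
  have hze : ¬ z i ∣ ((k + 1 : ℕ) : R) := fun h =>
    hprime.not_unit (isUnit_of_dvd_unit h (isUnit_natCast_of_not_dvd p (hk ▸ hi)))
  rcases hprime.dvd_or_dvd hdvd with h4 | h4
  · rcases hprime.dvd_or_dvd h4 with h5 | h5
    · rcases hprime.dvd_or_dvd h5 with h6 | h6
      · exact absurd h6 hzu
      · exact absurd h6 hzQ
    · exact absurd h5 hze
  · exact h4

/-! ## Derivations killing `G` kill the line -/

/-- A derivation of a ring `F` of prime characteristic `p` killing `G` kills every representative `Σ_j c_j^p G^j` of the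
`F^p`-line of `G` (`D (c^p) = p c^{p-1} D c = 0`, `D (G^j) = j G^{j-1} D G = 0`). [folklore] -/
theorem derivation_rep_eq_zero {F : Type v} [CommRing F] (p : ℕ) [CharP F p] (D : Derivation ℤ F F) {G : F} (hDG : D G = 0)
    {ι : Type*} (s : Finset ι) (cc : ι → F) (j : ι → ℕ) :
    D (∑ i ∈ s, cc i ^ p * G ^ (j i)) = 0 := by
  rw [map_sum]
  refine Finset.sum_eq_zero fun i _ => ?_
  rw [Derivation.leibniz, Derivation.leibniz_pow, Derivation.leibniz_pow, hDG]
  simp only [smul_eq_mul, nsmul_eq_mul, CharP.cast_eq_zero, zero_mul, mul_zero, add_zero]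

/-- Transport along `f`: if `D ∘ f = f ∘ d` and `f` is injective, then `D (f r) = 0` forces `d r = 0`. [folklore] -/
theorem derivation_apply_eq_zero_of_comp {R : Type u} {F : Type v} [CommRing R] [CommRing F] {f : R →+* F}
    (hf : Function.Injective f) {D : Derivation ℤ F F} {d : Derivation ℤ R R} (hcomp : ∀ r, D (f r) = f (d r)) {r : R}
    (h : D (f r) = 0) : d r = 0 := by
  rw [hcomp] at h
  exact hf (by rw [h, map_zero])

/-! ## The obstruction -/

/-- Bookkeeping: the two blocks of `Fin.append c w` recombine the adapted monomial. [folklore] -/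
theorem prod_append_pow_eq {R : Type u} [CommMonoid R] {n l : ℕ} (c : Fin n → R) (w : Fin l → R) (a : Fin n → ℕ)
    (b : Fin l → ℕ) :
    ∏ i, Fin.append c w i ^ Fin.append a b i = (∏ k, c k ^ a k) * ∏ m, w m ^ b m := by
  rw [Fin.prod_univ_add]
  simp only [Fin.append_left, Fin.append_right]

/-- Bookkeeping: an adapted regular system of parameters `(c, w)` of `CleanPermissibleAt` is a part (indeed the whole) of a regular
system of parameters in the sense of `IsRsopPart`. [folklore] -/
theorem isRsopPart_append_of_span_range_append {R : Type u} [CommRing R] [IsLocalRing R] (hR : IsRegularLocalRing R) {n l : ℕ}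
    (c : Fin n → R) (w : Fin l → R) (hspan : Ideal.span (Set.range (Fin.append c w)) = maximalIdeal R)
    (hdim : ringKrullDim R = ((n + l : ℕ) : WithBot ℕ∞)) : IsRsopPart (Fin.append c w) := by
  refine ⟨hR, 0, Fin.elim0, by rw [hdim]; norm_cast, ?_⟩
  have h0 : Set.range (Fin.elim0 : Fin 0 → R) = ∅ := Set.range_eq_empty _
  rw [h0, Set.union_empty, hspan]

/-- A later member `w m` of a regular system of parameters `(c, w)` does not lie in `(c) + 𝔪²` (linear independence of a minimal basis of
`𝔪` modulo `𝔪²`). [cite: Matsumura1987, Thm. 14.2] -/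
theorem append_right_not_mem_span_sup_sq {R : Type u} [CommRing R] [IsLocalRing R] {n l : ℕ} {c : Fin n → R} {w : Fin l → R}
    (hz : IsRsopPart (Fin.append c w)) (m : Fin l) :
    w m ∉ Ideal.span (Set.range c) ⊔ maximalIdeal R ^ 2 := by
  classical
  intro hmem
  obtain ⟨y, hy, q, hq, hyq⟩ := Submodule.mem_sup.mp hmem
  obtain ⟨r, hr⟩ := Ideal.mem_span_range_iff_exists_fun.mp hy
  -- the relation `w m - Σ r_k c_k ∈ 𝔪²` as a relation among the members of `Fin.append c w`
  let coef : Fin (n + l) → R := Fin.append (fun k => -r k) (Pi.single m 1)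
  have hsum : ∑ i, coef i * Fin.append c w i = w m - ∑ k, r k * c k := by
    rw [Fin.sum_univ_add]
    simp only [coef, Fin.append_left, Fin.append_right, neg_mul, Finset.sum_neg_distrib, Pi.single_apply, ite_mul, one_mul,
      zero_mul, Finset.sum_ite_eq', Finset.mem_univ, if_true]
    ring
  have hrel : ∑ i, coef i * Fin.append c w i ∈ maximalIdeal R ^ 2 := by
    rw [hsum, hr]
    have hwy : w m - y = q := by rw [← hyq]; ring
    rw [hwy]
    exact hq
  have h1 := hz.forall_mem_maximalIdeal_of_sum_mul_mem_sq coef hrel (Fin.natAdd n m)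
  simp only [coef, Fin.append_right, Pi.single_eq_same] at h1
  exact (maximalIdeal.isMaximal R).ne_top (Ideal.eq_top_of_isUnit_mem _ h1 isUnit_one)

/-- **THE DERIVATION OBSTRUCTION TO CLEAN-PERMISSIBILITY.**  Let `f : R → F` be injective into a field of characteristic `p`, and suppose
the residue field of the local ring `R` is `p`-perfect in the elementary sense «every `u ∈ R` is a `p`-th power modulo `𝔪`» (so loose clean
form (2) is void at `R`).  If the `F^p`-line of `G` is clean-permissible at `R` for the centre ideal `I`, then there is an element `x` which is
either a minimal generator of `I` (`x ∈ I`, `x ∉ 𝔪²`) or a parameter transversal to `I` (`x ∈ 𝔪`, `x ∉ I + 𝔪²`) such that `x ∣ d x` for EVERY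
derivation `d` of `R` extending along `f` to a derivation `D` of `F` with `D G = 0`.  (Proof: form (2) contradicts perfectness; in form (1)
take the member of the adapted system `(c, w)` carrying an exponent prime to `p` and apply the Leibniz divisibility to `d (u ∏ c^a ∏ w^b) = 0`,
which holds because `D` kills the representative `Σ c_j^p G^j`.) [cite: Piltant2013, §2 Axiom 4] [cite: Matsumura1987, Thm. 14.2] -/
theorem CleanPermissibleAt.exists_adapted_dvd_derivation {R : Type u} {F : Type u} [CommRing R] [IsLocalRing R] [Field F] {p : ℕ}
    [hp : Fact p.Prime] [CharP F p] {f : R →+* F} (hf : Function.Injective f) {G : F} {I : Ideal R}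
    (h : CleanPermissibleAt p f G I) (hperf : ∀ u : R, ∃ c : R, u - c ^ p ∈ maximalIdeal R) :
    ∃ x : R, ((x ∈ I ∧ x ∉ maximalIdeal R ^ 2) ∨ (x ∈ maximalIdeal R ∧ x ∉ I ⊔ maximalIdeal R ^ 2)) ∧
      ∀ (D : Derivation ℤ F F) (d : Derivation ℤ R R), (∀ r, D (f r) = f (d r)) → D G = 0 → x ∣ d x := by
  classical
  haveI : CharP R p := f.charP hf p
  obtain ⟨hR, n, l, c, w, hspan, hdim, hcI, cc, -, hform⟩ := h
  have hz : IsRsopPart (Fin.append c w) := isRsopPart_append_of_span_range_append hR c w hspan hdim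
  rcases hform with ⟨a, b, u, hu, hex, hrep⟩ | ⟨u, -, -, hnot⟩
  · -- form (1): the representative is `f (u ∏ c^a ∏ w^b) = f (u ∏ z^e)`
    have hrep' : (∑ j : Fin p, cc j ^ p * G ^ (j : ℕ)) = f (u * ∏ i, Fin.append c w i ^ Fin.append a b i) := by
      rw [hrep, prod_append_pow_eq, mul_assoc]
    have hkill : ∀ (D : Derivation ℤ F F) (d : Derivation ℤ R R), (∀ r, D (f r) = f (d r)) → D G = 0 →
        d (u * ∏ i, Fin.append c w i ^ Fin.append a b i) = 0 := fun D d hcomp hDG =>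
      derivation_apply_eq_zero_of_comp hf hcomp
        (by rw [← hrep']; exact derivation_rep_eq_zero p D hDG Finset.univ cc (fun j => (j : ℕ)))
    rcases hex with ⟨k, hk⟩ | ⟨m, hm⟩
    · refine ⟨c k, Or.inl ⟨hcI ▸ Ideal.subset_span ⟨k, rfl⟩, ?_⟩, fun D d hcomp hDG => ?_⟩
      · have := hz.not_mem_sq (Fin.castAdd l k)
        rwa [Fin.append_left] at this
      · have := hz.dvd_derivation_apply_of_apply_eq_zero p d hu (Fin.append a b) (hkill D d hcomp hDG)
          (i := Fin.castAdd l k) (by rwa [Fin.append_left])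
        rwa [Fin.append_left] at this
    · refine ⟨w m, Or.inr ⟨?_, ?_⟩, fun D d hcomp hDG => ?_⟩
      · have := hz.mem_maximalIdeal (Fin.natAdd n m)
        rwa [Fin.append_right] at this
      · rw [← hcI]; exact append_right_not_mem_span_sup_sq hz m
      · have := hz.dvd_derivation_apply_of_apply_eq_zero p d hu (Fin.append a b) (hkill D d hcomp hDG)
          (i := Fin.natAdd n m) (by rwa [Fin.append_right])
        rwa [Fin.append_right] at this
  · -- form (2) is void over a `p`-perfect residue field
    obtain ⟨c', hc'⟩ := hperf u
    exact absurd hc' (hnot c')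

/-- **Contrapositive, in the form used by hand**: to show that the line of `G` is NOT clean-permissible at `R` for `I` (residue field
`p`-perfect), exhibit for every minimal generator `x` of `I` and for every parameter `x` transversal to `I` a derivation `d` of `R`, extending
along `f` to a derivation of `F` killing `G`, with `x ∤ d x`. [cite: Piltant2013, §2 Axiom 4] -/
theorem not_cleanPermissibleAt_of_derivations {R : Type u} {F : Type u} [CommRing R] [IsLocalRing R] [Field F] {p : ℕ}
    [Fact p.Prime] [CharP F p] {f : R →+* F} (hf : Function.Injective f) {G : F} {I : Ideal R}
    (hperf : ∀ u : R, ∃ c : R, u - c ^ p ∈ maximalIdeal R)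
    (hgen : ∀ x ∈ I, x ∉ maximalIdeal R ^ 2 →
      ∃ (D : Derivation ℤ F F) (d : Derivation ℤ R R), (∀ r, D (f r) = f (d r)) ∧ D G = 0 ∧ ¬ x ∣ d x)
    (htrans : ∀ x ∈ maximalIdeal R, x ∉ I ⊔ maximalIdeal R ^ 2 →
      ∃ (D : Derivation ℤ F F) (d : Derivation ℤ R R), (∀ r, D (f r) = f (d r)) ∧ D G = 0 ∧ ¬ x ∣ d x) :
    ¬ CleanPermissibleAt p f G I := by
  intro h
  obtain ⟨x, hx, hdvd⟩ := h.exists_adapted_dvd_derivation hf hperf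
  rcases hx with ⟨hxI, hx2⟩ | ⟨hxm, hx2⟩
  · obtain ⟨D, d, hcomp, hDG, hnd⟩ := hgen x hxI hx2
    exact hnd (hdvd D d hcomp hDG)
  · obtain ⟨D, d, hcomp, hDG, hnd⟩ := htrans x hxm hx2
    exact hnd (hdvd D d hcomp hDG)

/-! ## Second order: the logarithmic derivative (appended, same seat) -/

/-- **Leibniz for an adapted monomial, in characteristic `p`.**  If `d zᵢ = zᵢ · rᵢ` for every index with `p ∤ eᵢ` (the indices with
`p ∣ eᵢ` contribute nothing: `eᵢ = 0` in `R`), then `d (∏ zᵢ^{eᵢ}) = (∏ zᵢ^{eᵢ}) · Σᵢ eᵢ rᵢ`. [folklore] -/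
theorem derivation_prod_pow_eq_mul_sum {R : Type u} [CommRing R] (p : ℕ) [CharP R p] (d : Derivation ℤ R R) :
    ∀ {N : ℕ} (z : Fin N → R) (e : Fin N → ℕ) (r : Fin N → R), (∀ i, ¬ p ∣ e i → d (z i) = z i * r i) →
      d (∏ i, z i ^ e i) = (∏ i, z i ^ e i) * ∑ i, (e i : R) * r i := by
  intro N
  induction N with
  | zero =>
    intro z e r _
    simp
  | succ N ih =>
    intro z e r hr
    rw [Fin.prod_univ_castSucc, Fin.sum_univ_castSucc, Derivation.leibniz, Derivation.leibniz_pow,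
      ih (fun i => z (Fin.castSucc i)) (fun i => e (Fin.castSucc i)) (fun i => r (Fin.castSucc i))
        (fun i hi => hr (Fin.castSucc i) hi)]
    simp only [smul_eq_mul, nsmul_eq_mul]
    by_cases hlast : p ∣ e (Fin.last N)
    · have h0 : ((e (Fin.last N) : ℕ) : R) = 0 := (CharP.cast_eq_zero_iff R p _).mpr hlast
      rw [h0]
      ring
    · have hd := hr (Fin.last N) hlast
      have he : e (Fin.last N) ≠ 0 := fun h => hlast (h ▸ dvd_zero p)
      obtain ⟨k, hk⟩ := Nat.exists_eq_add_one_of_ne_zero he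
      rw [hd, hk, Nat.add_sub_cancel, pow_succ]
      ring

/-- **The logarithmic derivative.**  Let `z` be part of a regular system of parameters of the local ring `R` (`char R = p` prime), `u` a unit,
`e` exponents and `d` a derivation of `R` with `d (u · ∏ᵢ zᵢ^{eᵢ}) = 0`.  Then there are `rᵢ` with `d zᵢ = zᵢ rᵢ` whenever `p ∤ eᵢ` (Leibniz
divisibility) AND `d u + u · Σᵢ eᵢ rᵢ = 0` — i.e. `Σᵢ eᵢ rᵢ = -d log u`.  Consequence used by hand: if `d (R) ⊆ 𝔪` then `Σᵢ eᵢ rᵢ ∈ 𝔪`; with a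
single index prime to `p` this reads `d zᵢ ∈ zᵢ 𝔪`, which excludes e.g. an exceptional coordinate `z` with `d z = -z`.
[cite: Matsumura1987, Thm. 14.3] -/
theorem _root_.Literature.AlgebraicGeometry.Resolution.IsRsopPart.exists_logDerivative_of_apply_eq_zero {R : Type u} [CommRing R]
    [IsLocalRing R] {N : ℕ} {z : Fin N → R} (hz : IsRsopPart z) (p : ℕ) [Fact p.Prime] [CharP R p] (d : Derivation ℤ R R)
    {u : R} (hu : IsUnit u) (e : Fin N → ℕ) (h0 : d (u * ∏ i, z i ^ e i) = 0) :
    ∃ r : Fin N → R, (∀ i, ¬ p ∣ e i → d (z i) = z i * r i) ∧ d u + u * ∑ i, (e i : R) * r i = 0 := by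
  classical
  haveI := hz.isRegularLocalRing
  haveI := isDomain_of_isRegularLocalRing R
  have hdvd : ∀ i, ¬ p ∣ e i → z i ∣ d (z i) := fun i hi => hz.dvd_derivation_apply_of_apply_eq_zero p d hu e h0 hi
  let r : Fin N → R := fun i => if hi : ¬ p ∣ e i then Classical.choose (hdvd i hi) else 0
  have hr : ∀ i, ¬ p ∣ e i → d (z i) = z i * r i := fun i hi => by
    simp only [r, dif_pos hi]
    exact Classical.choose_spec (hdvd i hi)
  refine ⟨r, hr, ?_⟩
  have hP : ∏ i, z i ^ e i ≠ 0 := Finset.prod_ne_zero_iff.mpr fun i _ => pow_ne_zero _ (hz.ne_zero i)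
  have h1 : d (u * ∏ i, z i ^ e i) = (∏ i, z i ^ e i) * (d u + u * ∑ i, (e i : R) * r i) := by
    rw [Derivation.leibniz, derivation_prod_pow_eq_mul_sum p d z e r hr]
    simp only [smul_eq_mul]
    ring
  rw [h0] at h1
  exact (mul_eq_zero.mp h1.symm).resolve_left hP

/-- If a derivation maps `R` into `𝔪` and kills `u · ∏ zᵢ^{eᵢ}` (`u` a unit, `z` part of a regular system of parameters), then the weighted sum
of the logarithmic derivatives `Σᵢ eᵢ (d zᵢ / zᵢ)` lies in `𝔪`. [folklore] -/
theorem _root_.Literature.AlgebraicGeometry.Resolution.IsRsopPart.sum_logDerivative_mem_maximalIdeal {R : Type u} [CommRing R]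
    [IsLocalRing R] {N : ℕ} {z : Fin N → R} (hz : IsRsopPart z) (p : ℕ) [Fact p.Prime] [CharP R p] (d : Derivation ℤ R R)
    (hd : ∀ x : R, d x ∈ maximalIdeal R) {u : R} (hu : IsUnit u) (e : Fin N → ℕ) (h0 : d (u * ∏ i, z i ^ e i) = 0) :
    ∃ r : Fin N → R, (∀ i, ¬ p ∣ e i → d (z i) = z i * r i) ∧ ∑ i, (e i : R) * r i ∈ maximalIdeal R := by
  obtain ⟨r, hr, hsum⟩ := hz.exists_logDerivative_of_apply_eq_zero p d hu e h0
  refine ⟨r, hr, ?_⟩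
  obtain ⟨v, rfl⟩ := hu
  have h1 : ∑ i, (e i : R) * r i = -(↑v⁻¹ * d (v : R)) := by
    have h2 : (v : R) * ∑ i, (e i : R) * r i = -d (v : R) := by linear_combination hsum
    calc ∑ i, (e i : R) * r i = ↑v⁻¹ * ((v : R) * ∑ i, (e i : R) * r i) := by rw [← mul_assoc, Units.inv_mul, one_mul]
      _ = -(↑v⁻¹ * d (v : R)) := by rw [h2, mul_neg]
  rw [h1]
  exact neg_mem (Ideal.mul_mem_left _ _ (hd _))

/-- **The raw adapted presentation**, for finer tests than divisibility: if the residue field is `p`-perfect and the line of `G` is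
clean-permissible at `R` for `I`, there is an adapted regular system of parameters `(c, w)` (`(c) = I`), exponents `(a, b)` with one of them prime
to `p` and a unit `u` such that EVERY derivation `d` of `R` extending along `f` to a derivation of `F` killing `G` kills `u · ∏ c^a · ∏ w^b`; feed
this to `IsRsopPart.dvd_derivation_apply_of_apply_eq_zero` / `IsRsopPart.exists_logDerivative_of_apply_eq_zero` /
`IsRsopPart.sum_logDerivative_mem_maximalIdeal`. [cite: Piltant2013, §2 Axiom 4] -/
theorem CleanPermissibleAt.exists_adapted_apply_eq_zero {R : Type u} {F : Type u} [CommRing R] [IsLocalRing R] [Field F] {p : ℕ}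
    [Fact p.Prime] [CharP F p] {f : R →+* F} (hf : Function.Injective f) {G : F} {I : Ideal R}
    (h : CleanPermissibleAt p f G I) (hperf : ∀ u : R, ∃ c : R, u - c ^ p ∈ maximalIdeal R) :
    ∃ (n l : ℕ) (c : Fin n → R) (w : Fin l → R) (a : Fin n → ℕ) (b : Fin l → ℕ) (u : R),
      IsRsopPart (Fin.append c w) ∧ Ideal.span (Set.range c) = I ∧ IsUnit u ∧ ((∃ k, ¬ p ∣ a k) ∨ (∃ m, ¬ p ∣ b m)) ∧
      ∀ (D : Derivation ℤ F F) (d : Derivation ℤ R R), (∀ r, D (f r) = f (d r)) → D G = 0 →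
        d (u * ∏ i, Fin.append c w i ^ Fin.append a b i) = 0 := by
  obtain ⟨hR, n, l, c, w, hspan, hdim, hcI, cc, -, hform⟩ := h
  rcases hform with ⟨a, b, u, hu, hex, hrep⟩ | ⟨u, -, -, hnot⟩
  · refine ⟨n, l, c, w, a, b, u, isRsopPart_append_of_span_range_append hR c w hspan hdim, hcI, hu, hex, fun D d hcomp hDG => ?_⟩
    have hrep' : (∑ j : Fin p, cc j ^ p * G ^ (j : ℕ)) = f (u * ∏ i, Fin.append c w i ^ Fin.append a b i) := by
      rw [hrep, prod_append_pow_eq, mul_assoc]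
    exact derivation_apply_eq_zero_of_comp hf hcomp
      (by rw [← hrep']; exact derivation_rep_eq_zero p D hDG Finset.univ cc (fun j => (j : ℕ)))
  · obtain ⟨c', hc'⟩ := hperf u
    exact absurd hc' (hnot c')

/-! ## Over the field of fractions: derivations of `R` suffice (appended, same seat) -/

/-- Every derivation of a domain `R` extends along `R → Frac R` to a derivation of the field of fractions (tree:
`Derivation.fractionFieldExtend`, Bourbaki Alg. II V §16 no. 2). [folklore] -/
theorem exists_derivation_extend_fractionRing {R : Type u} {F : Type u} [CommRing R] [IsDomain R] [Field F] [Algebra R F]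
    [IsFractionRing R F] (d : Derivation ℤ R R) :
    ∃ D : Derivation ℤ F F, ∀ r, D (algebraMap R F r) = algebraMap R F (d r) := by
  refine ⟨((Algebra.linearMap R F).compDer d).fractionFieldExtend (F := F), fun r => ?_⟩
  rw [Derivation.fractionFieldExtend_algebraMap]
  rfl

/-- **First-order criterion over the field of fractions, with derivations of `R` only.**  `R` a local domain with `p`-perfect residue field,
`F = Frac R` of characteristic `p`, `G = g ∈ R`: if every minimal generator of `I` and every parameter transversal to `I` admits a derivation `d` of
`R` with `d g = 0` and `x ∤ d x`, then the line of `g` is not clean-permissible at `R` for `I` (the extensions to `F` are supplied by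
`exists_derivation_extend_fractionRing`).  For `G = g₁ / c^p` use the same statement with `g₁`: the `F^p`-line is unchanged by `p`-th power factors.
[cite: Piltant2013, §2 Axiom 4] -/
theorem not_cleanPermissibleAt_of_derivations_fractionRing {R : Type u} {F : Type u} [CommRing R] [IsLocalRing R] [IsDomain R] [Field F]
    [Algebra R F] [IsFractionRing R F] {p : ℕ} [Fact p.Prime] [CharP F p] {g : R} {I : Ideal R}
    (hperf : ∀ u : R, ∃ c : R, u - c ^ p ∈ maximalIdeal R)
    (hgen : ∀ x ∈ I, x ∉ maximalIdeal R ^ 2 → ∃ d : Derivation ℤ R R, d g = 0 ∧ ¬ x ∣ d x)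
    (htrans : ∀ x ∈ maximalIdeal R, x ∉ I ⊔ maximalIdeal R ^ 2 → ∃ d : Derivation ℤ R R, d g = 0 ∧ ¬ x ∣ d x) :
    ¬ CleanPermissibleAt p (algebraMap R F) (algebraMap R F g) I := by
  have hf : Function.Injective (algebraMap R F) := IsFractionRing.injective R F
  refine not_cleanPermissibleAt_of_derivations hf hperf (fun x hxI hx2 => ?_) (fun x hxm hx2 => ?_)
  · obtain ⟨d, hdg, hnd⟩ := hgen x hxI hx2
    obtain ⟨D, hD⟩ := exists_derivation_extend_fractionRing (F := F) d
    exact ⟨D, d, hD, by rw [hD, hdg, map_zero], hnd⟩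
  · obtain ⟨d, hdg, hnd⟩ := htrans x hxm hx2
    obtain ⟨D, hD⟩ := exists_derivation_extend_fractionRing (F := F) d
    exact ⟨D, d, hD, by rw [hD, hdg, map_zero], hnd⟩

/-- **`p`-th power factors do not change the line**: the representatives `Σ c_j^p (c^p G)^j` of the line of `c^p G` are exactly the representatives
`Σ (c_j c^j)^p G^j` of the line of `G`, so clean-permissibility is invariant under `G ↦ c^p G` (`c ≠ 0`). [folklore] -/
theorem CleanPermissibleAt.of_mul_pow {R : Type u} {F : Type u} [CommRing R] [Field F] {p : ℕ} {f : R →+* F} {G : F} {I : Ideal R}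
    {c : F} (hc : c ≠ 0) (h : CleanPermissibleAt p f (c ^ p * G) I) : CleanPermissibleAt p f G I := by
  obtain ⟨hR, n, l, cv, w, hspan, hdim, hcI, cc, ⟨j, hj, hccj⟩, hform⟩ := h
  have hrew : (∑ i : Fin p, cc i ^ p * (c ^ p * G) ^ (i : ℕ)) = ∑ i : Fin p, (cc i * c ^ (i : ℕ)) ^ p * G ^ (i : ℕ) :=
    Finset.sum_congr rfl fun i _ => by ring
  refine ⟨hR, n, l, cv, w, hspan, hdim, hcI, fun i => cc i * c ^ (i : ℕ), ⟨j, hj, mul_ne_zero hccj (pow_ne_zero _ hc)⟩, ?_⟩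
  rw [← hrew]
  exact hform

end Summit.ResolutionOfSingularities.ResolutionOfSingularities.Theorems.RadicialJung.CleanModels

end
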